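import Summits.AtomisticToContinuum.Crystallization.Theorems.FrustratedLawDichotomyEnergyRemainder

/-!
# FrustratedLawDichotomy · residual crux `AperiodicFrustratedLawGap` (stmt-AtomisticToContinuum-27623) — the LJ PAIR-FORCE TAYLOR REMAINDER, RADIAL/TRANSVERSE SPLIT
# (hdef side, class A, T1b-F: the SPLIT filler for the force-remainder slot `fR` of T2 `…CoherentFloorAlgebra.windowSum_ge`; companion of NODE-10
# `…ForceRemainder` (isotropic, second order) and NODE-12 `…EnergyRemainder`; decomp-a2c hand-1 g52, critic r1752 (a) «the radial/transverse split is load-bearing»)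

For the tree's pair force `g x = ψ(‖x‖²) • x`, `ψ t = t⁻¹^4 - t⁻¹^7`, `ψ′ t = -4 t⁻¹^5 + 7 t⁻¹^8`, `½ψ″ t = 10 t⁻¹^6 - 28 t⁻¹^9`, and its linearisation
`L x δ = ψ(‖x‖²) • δ + (2⟪x,δ⟫ ψ′(‖x‖²)) • x`, this file books the remainder `g (x+δ) - g x - L x δ` to SECOND order EXACTLY in the FIXED reference frame of the bond
`x` and bounds it as a QUADRATIC FORM in the displacement `δ` that separates the RADIAL STRETCH `⟪x,δ⟫/‖x‖` from `‖δ‖`: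

* `inv_pow_four_taylor₃`, `inv_pow_seven_taylor₃` — exact third-order identities `t₁⁻¹^k - [t₀⁻¹^k - k t₀⁻¹^(k+1) Δ + (k(k+1)/2) t₀⁻¹^(k+2) Δ²] = -Δ³ C_k(t₀,t₁)`
  (k = 4, 7; third divided differences) with `0 ≤ C₄ ≤ 20 ρ⁻¹^7`, `0 ≤ C₇ ≤ 84 ρ⁻¹^10` on `ρ ≤ t₀, t₁`; `psi_taylor₃_abs_le` —
  `|ψ t₁ - ψ t₀ - ψ′ t₀ Δ - ½ψ″ t₀ Δ²| ≤ max (20 ρ⁻¹^7) (84 ρ⁻¹^10) · |Δ|³`;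
* `force_remainder_eq₃` — the exact vector identity, ARBITRARY scalars `a = ψ₀, b = ψ₁, c = ψ′₀, d = ½ψ″₀`, `p = ⟪x,δ⟫`, `Δ = ‖x+δ‖² - ‖x‖² = 2p + ‖δ‖²`:
  `g(x+δ) - g x - L x δ = (b - a - cΔ - dΔ²) • (x+δ) + MAIN + TAIL`, `MAIN = (c‖δ‖² + 4dp²) • x + (2cp) • δ = ½·D³Φ(x)[δ,δ]` (`Φ v = φ(‖v‖²)`),
  `TAIL = (c‖δ‖²) • δ + (d‖δ‖²(4p + ‖δ‖²)) • x + (dΔ²) • δ` (cubic and higher);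
* `norm_main_split_le` — with `S = p²/‖x‖²` (squared radial stretch) and `T = ‖δ‖² - S` (squared transverse part), for every `α > 0`:
  `‖MAIN‖ ≤ ‖x‖·|3c + 4d‖x‖²|·S + ½|c|‖x‖·(αT + (T + 4S)/α)`; here `‖x‖·|3ψ′ + 2‖x‖²ψ″| = ½|V_LJ‴(‖x‖)|` keeps the cancellation between the two radial
  third-derivative terms, and `α = √3` gives the sharp isotropic constant `2/√3` of the transverse part `‖δ_t²·x̂ + 2δ_rδ_t·t̂‖ ≤ (2/√3)‖δ‖²` (any rational `α`
  is admissible for kernel-checked cell files);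
* ★ `norm_force_remainder_split_le` — for `‖δ‖ ≤ η < ‖x‖`, `0 < α`, with `r = ‖x‖`, `ρ = (r - η)²`, `D = 2rη + η²`:
  `‖g(x+δ) - g x - L x δ‖ ≤ Cr · ⟪x,δ⟫²/‖x‖² + Ct · ‖δ‖²`,
  `Cr = r|3c + 4dr²| + ½|c| r (4/α - α - 1/α) + max(20ρ⁻¹^7, 84ρ⁻¹^10)(r+η) D (4r² + 2rη) + |d|(2r²η + η(4r² + 2rη))`,
  `Ct = ½|c| r (α + 1/α) + max(20ρ⁻¹^7, 84ρ⁻¹^10)(r+η) D² + |c| η + |d|(r+η) D`  (`c = ψ′(r²)`, `d = ½ψ″(r²)`) — the leading terms are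
  `½|V_LJ‴(r)|` (radial) and `(α+1/α)/2 · r|ψ′(r²)| = (α+1/α)/4 · |V_LJ″(r)/r - V_LJ′(r)/r²|` (transverse), the rest is `O(η)` and explicit.

This is the per-bond SPLIT booking `|R_b| ≤ ½[C_r (δu·n̂)² + C_t |δu|²]` of the census's N7 table (there with moving-frame constants; here in the fixed frame of the
template bond, so `δu·n̂` is literally the linear functional the cell certificate uses), with closed-form constants: no sup-hypotheses to discharge per cell.
DEF-FREE; imports only the tree companions (209) `…ForceRemainder` / (217) `…EnergyRemainder`; general real inner-product space.
[folklore: Taylor remainder of a rational radial vector field via divided differences; third derivative of a radial function]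
-/

namespace Summit.AtomisticToContinuum.Crystallization.Theorems.FrustratedLawDichotomyForceRemainderSplit

open RealInnerProductSpace
open Summit.AtomisticToContinuum.Crystallization.Theorems.FrustratedLawDichotomyForceRemainder (inv_pow_le_inv_pow abs_norm_add_sq_sub_le
  sq_le_norm_add_sq_of_le)
open Summit.AtomisticToContinuum.Crystallization.Theorems.FrustratedLawDichotomyEnergyRemainder (inv_pow_mul_inv_pow_le)

/-! ## Scalar part: exact third-order Taylor identities for `t⁻¹ ^ 4` and `t⁻¹ ^ 7` -/

/-- exact: `t₁⁻⁴ - t₀⁻⁴ + 4 t₀⁻⁵ Δ - 10 t₀⁻⁶ Δ² = -Δ³ C₄`. [folklore] -/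
theorem inv_pow_four_taylor₃ {t₀ t₁ : ℝ} (h₀ : t₀ ≠ 0) (h₁ : t₁ ≠ 0) :
    t₁⁻¹ ^ 4 - t₀⁻¹ ^ 4 + 4 * t₀⁻¹ ^ 5 * (t₁ - t₀) - 10 * t₀⁻¹ ^ 6 * (t₁ - t₀) ^ 2
      = -((t₁ - t₀) ^ 3 * (t₀⁻¹ ^ 3 * t₁⁻¹ ^ 4 + 3 * (t₀⁻¹ ^ 4 * t₁⁻¹ ^ 3) + 6 * (t₀⁻¹ ^ 5 * t₁⁻¹ ^ 2) + 10 * (t₀⁻¹ ^ 6 * t₁⁻¹))) := by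
  field_simp
  ring

/-- exact: `t₁⁻⁷ - t₀⁻⁷ + 7 t₀⁻⁸ Δ - 28 t₀⁻⁹ Δ² = -Δ³ C₇`. [folklore] -/
theorem inv_pow_seven_taylor₃ {t₀ t₁ : ℝ} (h₀ : t₀ ≠ 0) (h₁ : t₁ ≠ 0) :
    t₁⁻¹ ^ 7 - t₀⁻¹ ^ 7 + 7 * t₀⁻¹ ^ 8 * (t₁ - t₀) - 28 * t₀⁻¹ ^ 9 * (t₁ - t₀) ^ 2
      = -((t₁ - t₀) ^ 3 * (t₀⁻¹ ^ 3 * t₁⁻¹ ^ 7 + 3 * (t₀⁻¹ ^ 4 * t₁⁻¹ ^ 6) + 6 * (t₀⁻¹ ^ 5 * t₁⁻¹ ^ 5) + 10 * (t₀⁻¹ ^ 6 * t₁⁻¹ ^ 4)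
          + 15 * (t₀⁻¹ ^ 7 * t₁⁻¹ ^ 3) + 21 * (t₀⁻¹ ^ 8 * t₁⁻¹ ^ 2) + 28 * (t₀⁻¹ ^ 9 * t₁⁻¹))) := by
  field_simp
  ring

/-- `0 ≤ C₄ ≤ 20 ρ⁻⁷` on `ρ ≤ t₀, t₁`. [folklore] -/
theorem inv_pow_four_taylor₃_le {ρ t₀ t₁ : ℝ} (hρ : 0 < ρ) (h₀ : ρ ≤ t₀) (h₁ : ρ ≤ t₁) :
    0 ≤ t₀⁻¹ ^ 3 * t₁⁻¹ ^ 4 + 3 * (t₀⁻¹ ^ 4 * t₁⁻¹ ^ 3) + 6 * (t₀⁻¹ ^ 5 * t₁⁻¹ ^ 2) + 10 * (t₀⁻¹ ^ 6 * t₁⁻¹) ∧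
    t₀⁻¹ ^ 3 * t₁⁻¹ ^ 4 + 3 * (t₀⁻¹ ^ 4 * t₁⁻¹ ^ 3) + 6 * (t₀⁻¹ ^ 5 * t₁⁻¹ ^ 2) + 10 * (t₀⁻¹ ^ 6 * t₁⁻¹) ≤ 20 * ρ⁻¹ ^ 7 := by
  have e1 := inv_pow_mul_inv_pow_le hρ h₀ h₁ 3 4
  have e2 := inv_pow_mul_inv_pow_le hρ h₀ h₁ 4 3
  have e3 := inv_pow_mul_inv_pow_le hρ h₀ h₁ 5 2
  have e4 := inv_pow_mul_inv_pow_le hρ h₀ h₁ 6 1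
  simp only [pow_one] at e4
  constructor <;> nlinarith [e1.1, e1.2, e2.1, e2.2, e3.1, e3.2, e4.1, e4.2]

/-- `0 ≤ C₇ ≤ 84 ρ⁻¹⁰` on `ρ ≤ t₀, t₁`. [folklore] -/
theorem inv_pow_seven_taylor₃_le {ρ t₀ t₁ : ℝ} (hρ : 0 < ρ) (h₀ : ρ ≤ t₀) (h₁ : ρ ≤ t₁) :
    0 ≤ t₀⁻¹ ^ 3 * t₁⁻¹ ^ 7 + 3 * (t₀⁻¹ ^ 4 * t₁⁻¹ ^ 6) + 6 * (t₀⁻¹ ^ 5 * t₁⁻¹ ^ 5) + 10 * (t₀⁻¹ ^ 6 * t₁⁻¹ ^ 4)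
          + 15 * (t₀⁻¹ ^ 7 * t₁⁻¹ ^ 3) + 21 * (t₀⁻¹ ^ 8 * t₁⁻¹ ^ 2) + 28 * (t₀⁻¹ ^ 9 * t₁⁻¹) ∧
    t₀⁻¹ ^ 3 * t₁⁻¹ ^ 7 + 3 * (t₀⁻¹ ^ 4 * t₁⁻¹ ^ 6) + 6 * (t₀⁻¹ ^ 5 * t₁⁻¹ ^ 5) + 10 * (t₀⁻¹ ^ 6 * t₁⁻¹ ^ 4)
          + 15 * (t₀⁻¹ ^ 7 * t₁⁻¹ ^ 3) + 21 * (t₀⁻¹ ^ 8 * t₁⁻¹ ^ 2) + 28 * (t₀⁻¹ ^ 9 * t₁⁻¹) ≤ 84 * ρ⁻¹ ^ 10 := by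
  have e1 := inv_pow_mul_inv_pow_le hρ h₀ h₁ 3 7
  have e2 := inv_pow_mul_inv_pow_le hρ h₀ h₁ 4 6
  have e3 := inv_pow_mul_inv_pow_le hρ h₀ h₁ 5 5
  have e4 := inv_pow_mul_inv_pow_le hρ h₀ h₁ 6 4
  have e5 := inv_pow_mul_inv_pow_le hρ h₀ h₁ 7 3
  have e6 := inv_pow_mul_inv_pow_le hρ h₀ h₁ 8 2
  have e7 := inv_pow_mul_inv_pow_le hρ h₀ h₁ 9 1
  simp only [pow_one] at e7
  constructor <;> nlinarith [e1.1, e1.2, e2.1, e2.2, e3.1, e3.2, e4.1, e4.2, e5.1, e5.2, e6.1, e6.2, e7.1, e7.2]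

/-- Third-order Taylor bound for `ψ t = t⁻¹^4 - t⁻¹^7` (`ψ′ t = -4 t⁻¹^5 + 7 t⁻¹^8`, `½ψ″ t = 10 t⁻¹^6 - 28 t⁻¹^9`):
`|ψ t₁ - ψ t₀ - ψ′ t₀ Δ - ½ψ″ t₀ Δ²| ≤ max (20 ρ⁻¹^7) (84 ρ⁻¹^10) · |Δ|³` on `0 < ρ ≤ t₀, t₁`. [folklore] -/
theorem psi_taylor₃_abs_le {ρ t₀ t₁ : ℝ} (hρ : 0 < ρ) (h₀ : ρ ≤ t₀) (h₁ : ρ ≤ t₁) :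
    |(t₁⁻¹ ^ 4 - t₁⁻¹ ^ 7) - (t₀⁻¹ ^ 4 - t₀⁻¹ ^ 7) - (-4 * t₀⁻¹ ^ 5 + 7 * t₀⁻¹ ^ 8) * (t₁ - t₀)
        - (10 * t₀⁻¹ ^ 6 - 28 * t₀⁻¹ ^ 9) * (t₁ - t₀) ^ 2|
      ≤ max (20 * ρ⁻¹ ^ 7) (84 * ρ⁻¹ ^ 10) * |t₁ - t₀| ^ 3 := by
  have ht₀ : t₀ ≠ 0 := (hρ.trans_le h₀).ne'
  have ht₁ : t₁ ≠ 0 := (hρ.trans_le h₁).ne'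
  have i4 := inv_pow_four_taylor₃ ht₀ ht₁
  have i7 := inv_pow_seven_taylor₃ ht₀ ht₁
  obtain ⟨c4l, c4u⟩ := inv_pow_four_taylor₃_le hρ h₀ h₁
  obtain ⟨c7l, c7u⟩ := inv_pow_seven_taylor₃_le hρ h₀ h₁
  set C₄ := t₀⁻¹ ^ 3 * t₁⁻¹ ^ 4 + 3 * (t₀⁻¹ ^ 4 * t₁⁻¹ ^ 3) + 6 * (t₀⁻¹ ^ 5 * t₁⁻¹ ^ 2) + 10 * (t₀⁻¹ ^ 6 * t₁⁻¹) with hC₄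
  set C₇ := t₀⁻¹ ^ 3 * t₁⁻¹ ^ 7 + 3 * (t₀⁻¹ ^ 4 * t₁⁻¹ ^ 6) + 6 * (t₀⁻¹ ^ 5 * t₁⁻¹ ^ 5) + 10 * (t₀⁻¹ ^ 6 * t₁⁻¹ ^ 4)
          + 15 * (t₀⁻¹ ^ 7 * t₁⁻¹ ^ 3) + 21 * (t₀⁻¹ ^ 8 * t₁⁻¹ ^ 2) + 28 * (t₀⁻¹ ^ 9 * t₁⁻¹) with hC₇
  -- the remainder equals `-(Δ³) · (C₄ - C₇)`
  have key : (t₁⁻¹ ^ 4 - t₁⁻¹ ^ 7) - (t₀⁻¹ ^ 4 - t₀⁻¹ ^ 7) - (-4 * t₀⁻¹ ^ 5 + 7 * t₀⁻¹ ^ 8) * (t₁ - t₀)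
        - (10 * t₀⁻¹ ^ 6 - 28 * t₀⁻¹ ^ 9) * (t₁ - t₀) ^ 2
        = -((t₁ - t₀) ^ 3) * (C₄ - C₇) := by
    linear_combination i4 - i7
  rw [key, abs_mul, abs_neg, abs_pow, mul_comm]
  refine mul_le_mul_of_nonneg_right ?_ (pow_nonneg (abs_nonneg _) 3)
  rw [abs_le]
  constructor
  · nlinarith [le_max_right (20 * ρ⁻¹ ^ 7) (84 * ρ⁻¹ ^ 10)]
  · nlinarith [le_max_left (20 * ρ⁻¹ ^ 7) (84 * ρ⁻¹ ^ 10)]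


/-! ## Vector part: the pair force `g x = ψ(‖x‖²) • x` in a real inner-product space, fixed reference frame -/

variable {V : Type*} [NormedAddCommGroup V] [InnerProductSpace ℝ V]

/-- Exact third-order bookkeeping with ARBITRARY scalars `a = ψ₀`, `b = ψ₁`, `c = ψ′₀`, `d = ½ψ″₀` (`p = ⟪x,δ⟫`, `Δ = ‖x+δ‖² - ‖x‖² = 2p + ‖δ‖²`):
`g(x+δ) - g x - L x δ = (b - a - cΔ - dΔ²) • (x+δ) + MAIN + TAIL` with `MAIN = (c‖δ‖² + 4dp²) • x + (2cp) • δ` (`= ½·D³Φ(x)[δ,δ]` for the true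
scalars) and `TAIL = (c‖δ‖²) • δ + (d‖δ‖²(4p + ‖δ‖²)) • x + (dΔ²) • δ`. [folklore] -/
theorem force_remainder_eq₃ (x δ : V) (a b c d : ℝ) :
    b • (x + δ) - a • x - (a • δ + (2 * ⟪x, δ⟫ * c) • x)
      = (b - a - c * (‖x + δ‖ ^ 2 - ‖x‖ ^ 2) - d * (‖x + δ‖ ^ 2 - ‖x‖ ^ 2) ^ 2) • (x + δ)
        + ((c * ‖δ‖ ^ 2 + 4 * d * ⟪x, δ⟫ ^ 2) • x + (2 * c * ⟪x, δ⟫) • δ)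
        + ((c * ‖δ‖ ^ 2) • δ + (d * (‖δ‖ ^ 2 * (4 * ⟪x, δ⟫ + ‖δ‖ ^ 2))) • x + (d * (‖x + δ‖ ^ 2 - ‖x‖ ^ 2) ^ 2) • δ) := by
  have hΔ : ‖x + δ‖ ^ 2 - ‖x‖ ^ 2 = 2 * ⟪x, δ⟫ + ‖δ‖ ^ 2 := by rw [norm_add_sq_real]; ring
  rw [hΔ]
  module

/-- `MAIN` in the frame `x`, `u = δ - (p/‖x‖²) • x` (`u ⊥ x` when `x ≠ 0`): the two `(p/‖x‖²) • x` terms cancel identically. [folklore] -/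
theorem main_eq_perp (x δ : V) (c d : ℝ) :
    (c * ‖δ‖ ^ 2 + 4 * d * ⟪x, δ⟫ ^ 2) • x + (2 * c * ⟪x, δ⟫) • δ
      = (c * ‖δ‖ ^ 2 + 4 * d * ⟪x, δ⟫ ^ 2 + 2 * c * ⟪x, δ⟫ * (⟪x, δ⟫ / ‖x‖ ^ 2)) • x
        + (2 * c * ⟪x, δ⟫) • (δ - (⟪x, δ⟫ / ‖x‖ ^ 2) • x) := by
  module

/-- The transverse part `u = δ - (⟪x,δ⟫/‖x‖²) • x` is orthogonal to `x`. [folklore] -/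
theorem inner_perp_eq_zero (x δ : V) (hx : x ≠ 0) : ⟪x, δ - (⟪x, δ⟫ / ‖x‖ ^ 2) • x⟫ = 0 := by
  have hr : ‖x‖ ≠ 0 := norm_ne_zero_iff.mpr hx
  rw [inner_sub_right, real_inner_smul_right, real_inner_self_eq_norm_sq]
  field_simp
  ring

/-- Pythagoras for the transverse part: `‖u‖² = ‖δ‖² - ⟪x,δ⟫²/‖x‖²`. [folklore] -/
theorem norm_perp_sq (x δ : V) (hx : x ≠ 0) : ‖δ - (⟪x, δ⟫ / ‖x‖ ^ 2) • x‖ ^ 2 = ‖δ‖ ^ 2 - ⟪x, δ⟫ ^ 2 / ‖x‖ ^ 2 := by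
  have hr : ‖x‖ ≠ 0 := norm_ne_zero_iff.mpr hx
  rw [norm_sub_sq_real, real_inner_smul_right, norm_smul, mul_pow, Real.norm_eq_abs, sq_abs, real_inner_comm x δ]
  field_simp
  ring

/-- Squared radial stretch `S = ⟪x,δ⟫²/‖x‖²` and squared transverse part `T = ‖δ‖² - S` are nonnegative. [folklore] -/
theorem perp_sq_nonneg (x δ : V) : 0 ≤ ‖δ‖ ^ 2 - ⟪x, δ⟫ ^ 2 / ‖x‖ ^ 2 := by
  by_cases hx : x = 0
  · simp [hx]
  · rw [← norm_perp_sq x δ hx]; positivity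

/-- ★ `‖MAIN‖ ≤ ‖x‖·|3c + 4d‖x‖²|·S + ½|c|‖x‖·(αT + (T + 4S)/α)` for every `α > 0` (`S = ⟪x,δ⟫²/‖x‖²`, `T = ‖δ‖² - S`): triangle inequality
between the pure-stretch term and the transverse term `(cT) • x + (2cp) • u`, whose norm is `|c|‖x‖·√(T² + 4ST) ≤ ½|c|‖x‖(αT + (T+4S)/α)`
(`α = √3`: `≤ (2/√3)|c|‖x‖·‖δ‖²`). [folklore] -/
theorem norm_main_split_le (x δ : V) (c d : ℝ) {α : ℝ} (hα : 0 < α) (hx : x ≠ 0) :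
    ‖(c * ‖δ‖ ^ 2 + 4 * d * ⟪x, δ⟫ ^ 2) • x + (2 * c * ⟪x, δ⟫) • δ‖
      ≤ ‖x‖ * |3 * c + 4 * d * ‖x‖ ^ 2| * (⟪x, δ⟫ ^ 2 / ‖x‖ ^ 2)
        + 1 / 2 * |c| * ‖x‖ * (α * (‖δ‖ ^ 2 - ⟪x, δ⟫ ^ 2 / ‖x‖ ^ 2)
            + ((‖δ‖ ^ 2 - ⟪x, δ⟫ ^ 2 / ‖x‖ ^ 2) + 4 * (⟪x, δ⟫ ^ 2 / ‖x‖ ^ 2)) / α) := by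
  have hr0 : 0 < ‖x‖ := norm_pos_iff.mpr hx
  have hr : ‖x‖ ≠ 0 := hr0.ne'
  have hxu := inner_perp_eq_zero x δ hx
  have huT := norm_perp_sq x δ hx
  have hT0 := perp_sq_nonneg x δ
  set p := ⟪x, δ⟫ with hp
  set S := p ^ 2 / ‖x‖ ^ 2 with hS
  set T := ‖δ‖ ^ 2 - S with hT
  set u := δ - (p / ‖x‖ ^ 2) • x with hu
  have hS0 : 0 ≤ S := by positivity
  have hpS : p ^ 2 = ‖x‖ ^ 2 * S := by rw [hS]; field_simp
  -- `MAIN = ((3c + 4d r²) S) • x + ((cT) • x + (2cp) • u)`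
  have hcoef : c * ‖δ‖ ^ 2 + 4 * d * p ^ 2 + 2 * c * p * (p / ‖x‖ ^ 2) = (3 * c + 4 * d * ‖x‖ ^ 2) * S + c * T := by
    rw [hT, hS]; field_simp; ring
  have hM : (c * ‖δ‖ ^ 2 + 4 * d * p ^ 2) • x + (2 * c * p) • δ
      = ((3 * c + 4 * d * ‖x‖ ^ 2) * S) • x + ((c * T) • x + (2 * c * p) • u) := by
    rw [main_eq_perp, hcoef, add_smul, add_assoc]
  -- the pure-stretch term
  have h1 : ‖((3 * c + 4 * d * ‖x‖ ^ 2) * S) • x‖ = ‖x‖ * |3 * c + 4 * d * ‖x‖ ^ 2| * S := by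
    rw [norm_smul, Real.norm_eq_abs, abs_mul, abs_of_nonneg hS0]; ring
  -- the transverse term, by Pythagoras and AM–GM
  have hB0 : 0 ≤ 1 / 2 * |c| * ‖x‖ * (α * T + (T + 4 * S) / α) := by positivity
  have h2 : ‖(c * T) • x + (2 * c * p) • u‖ ≤ 1 / 2 * |c| * ‖x‖ * (α * T + (T + 4 * S) / α) := by
    have hsq : ‖(c * T) • x + (2 * c * p) • u‖ ^ 2 = (c * T) ^ 2 * ‖x‖ ^ 2 + (2 * c * p) ^ 2 * T := by
      rw [norm_add_sq_real, real_inner_smul_left, real_inner_smul_right, hxu, norm_smul, norm_smul, mul_pow, mul_pow,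
        Real.norm_eq_abs, Real.norm_eq_abs, sq_abs, sq_abs, huT]
      ring
    refine (sq_le_sq₀ (norm_nonneg _) hB0).mp ?_
    rw [hsq]
    have hY : 4 * T ^ 2 + 16 * S * T ≤ (α * T + (T + 4 * S) / α) ^ 2 := by
      have e : (α * T + (T + 4 * S) / α) ^ 2 - (4 * T ^ 2 + 16 * S * T) = (α * T - (T + 4 * S) / α) ^ 2 := by
        field_simp; ring
      nlinarith [sq_nonneg (α * T - (T + 4 * S) / α), e]
    have hp2 : (2 * c * p) ^ 2 * T = 4 * c ^ 2 * (‖x‖ ^ 2 * S) * T := by rw [← hpS]; ring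
    have hsq' : (1 / 2 * |c| * ‖x‖ * (α * T + (T + 4 * S) / α)) ^ 2 = 1 / 4 * c ^ 2 * ‖x‖ ^ 2 * (α * T + (T + 4 * S) / α) ^ 2 := by
      rw [mul_pow, mul_pow, mul_pow, sq_abs]; ring
    rw [hp2, hsq']
    have hcr : 0 ≤ 1 / 4 * c ^ 2 * ‖x‖ ^ 2 := by positivity
    have := mul_le_mul_of_nonneg_left hY hcr
    nlinarith [this]
  calc ‖(c * ‖δ‖ ^ 2 + 4 * d * p ^ 2) • x + (2 * c * p) • δ‖
      = ‖((3 * c + 4 * d * ‖x‖ ^ 2) * S) • x + ((c * T) • x + (2 * c * p) • u)‖ := by rw [hM]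
    _ ≤ ‖((3 * c + 4 * d * ‖x‖ ^ 2) * S) • x‖ + ‖(c * T) • x + (2 * c * p) • u‖ := norm_add_le _ _
    _ ≤ ‖x‖ * |3 * c + 4 * d * ‖x‖ ^ 2| * S + 1 / 2 * |c| * ‖x‖ * (α * T + (T + 4 * S) / α) := by rw [h1]; linarith [h2]

/-- `‖TAIL‖ ≤ |c|‖δ‖³ + |d|‖δ‖²(4|⟪x,δ⟫| + ‖δ‖²)‖x‖ + |d|Δ²‖δ‖` (the `Δ²` is kept whole: it is mostly RADIAL, `Δ² ≤ (4r² + 2rη)·S + D·‖δ‖²`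
inside `norm_force_remainder_split_le`). [folklore] -/
theorem norm_tail_le (x δ : V) (c d : ℝ) :
    ‖(c * ‖δ‖ ^ 2) • δ + (d * (‖δ‖ ^ 2 * (4 * ⟪x, δ⟫ + ‖δ‖ ^ 2))) • x + (d * (‖x + δ‖ ^ 2 - ‖x‖ ^ 2) ^ 2) • δ‖
      ≤ |c| * ‖δ‖ ^ 3 + |d| * (‖δ‖ ^ 2 * (4 * |⟪x, δ⟫| + ‖δ‖ ^ 2)) * ‖x‖ + |d| * (‖x + δ‖ ^ 2 - ‖x‖ ^ 2) ^ 2 * ‖δ‖ := by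
  have hδ := norm_nonneg δ
  have h1 : ‖(c * ‖δ‖ ^ 2) • δ‖ = |c| * ‖δ‖ ^ 3 := by
    rw [norm_smul, Real.norm_eq_abs, abs_mul, abs_of_nonneg (sq_nonneg ‖δ‖)]; ring
  have h2 : ‖(d * (‖δ‖ ^ 2 * (4 * ⟪x, δ⟫ + ‖δ‖ ^ 2))) • x‖ ≤ |d| * (‖δ‖ ^ 2 * (4 * |⟪x, δ⟫| + ‖δ‖ ^ 2)) * ‖x‖ := by
    rw [norm_smul, Real.norm_eq_abs, abs_mul, abs_mul, abs_of_nonneg (sq_nonneg ‖δ‖)]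
    have h : |4 * ⟪x, δ⟫ + ‖δ‖ ^ 2| ≤ 4 * |⟪x, δ⟫| + ‖δ‖ ^ 2 := by
      calc |4 * ⟪x, δ⟫ + ‖δ‖ ^ 2| ≤ |4 * ⟪x, δ⟫| + |‖δ‖ ^ 2| := abs_add_le _ _
        _ = 4 * |⟪x, δ⟫| + ‖δ‖ ^ 2 := by rw [abs_mul, abs_of_nonneg (sq_nonneg ‖δ‖), abs_of_nonneg (by norm_num : (0:ℝ) ≤ 4)]
    have h0 : 0 ≤ |d| * ‖δ‖ ^ 2 := by positivity
    calc |d| * (‖δ‖ ^ 2 * |4 * ⟪x, δ⟫ + ‖δ‖ ^ 2|) * ‖x‖ = (|d| * ‖δ‖ ^ 2) * |4 * ⟪x, δ⟫ + ‖δ‖ ^ 2| * ‖x‖ := by ring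
      _ ≤ (|d| * ‖δ‖ ^ 2) * (4 * |⟪x, δ⟫| + ‖δ‖ ^ 2) * ‖x‖ := by gcongr
      _ = |d| * (‖δ‖ ^ 2 * (4 * |⟪x, δ⟫| + ‖δ‖ ^ 2)) * ‖x‖ := by ring
  have h3 : ‖(d * (‖x + δ‖ ^ 2 - ‖x‖ ^ 2) ^ 2) • δ‖ = |d| * (‖x + δ‖ ^ 2 - ‖x‖ ^ 2) ^ 2 * ‖δ‖ := by
    rw [norm_smul, Real.norm_eq_abs, abs_mul, abs_of_nonneg (sq_nonneg (‖x + δ‖ ^ 2 - ‖x‖ ^ 2))]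
  calc ‖(c * ‖δ‖ ^ 2) • δ + (d * (‖δ‖ ^ 2 * (4 * ⟪x, δ⟫ + ‖δ‖ ^ 2))) • x + (d * (‖x + δ‖ ^ 2 - ‖x‖ ^ 2) ^ 2) • δ‖
      ≤ ‖(c * ‖δ‖ ^ 2) • δ + (d * (‖δ‖ ^ 2 * (4 * ⟪x, δ⟫ + ‖δ‖ ^ 2))) • x‖ + ‖(d * (‖x + δ‖ ^ 2 - ‖x‖ ^ 2) ^ 2) • δ‖ :=
        norm_add_le _ _
    _ ≤ ‖(c * ‖δ‖ ^ 2) • δ‖ + ‖(d * (‖δ‖ ^ 2 * (4 * ⟪x, δ⟫ + ‖δ‖ ^ 2))) • x‖ + ‖(d * (‖x + δ‖ ^ 2 - ‖x‖ ^ 2) ^ 2) • δ‖ := by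
        linarith [norm_add_le ((c * ‖δ‖ ^ 2) • δ) ((d * (‖δ‖ ^ 2 * (4 * ⟪x, δ⟫ + ‖δ‖ ^ 2))) • x)]
    _ ≤ |c| * ‖δ‖ ^ 3 + |d| * (‖δ‖ ^ 2 * (4 * |⟪x, δ⟫| + ‖δ‖ ^ 2)) * ‖x‖ + |d| * (‖x + δ‖ ^ 2 - ‖x‖ ^ 2) ^ 2 * ‖δ‖ := by
        rw [h1, h3]; linarith [h2]

/-- Certificate socket (arbitrary scalars `a b c d`, any `α > 0`, `x ≠ 0`): the remainder's norm is at most the scalar third-order remainder times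
`‖x + δ‖`, plus the split `MAIN` bound, plus the `TAIL` bound. [folklore] -/
theorem norm_force_remainder_le_of_scalars₃ (x δ : V) (a b c d : ℝ) {α : ℝ} (hα : 0 < α) (hx : x ≠ 0) :
    ‖b • (x + δ) - a • x - (a • δ + (2 * ⟪x, δ⟫ * c) • x)‖
      ≤ |b - a - c * (‖x + δ‖ ^ 2 - ‖x‖ ^ 2) - d * (‖x + δ‖ ^ 2 - ‖x‖ ^ 2) ^ 2| * ‖x + δ‖
        + (‖x‖ * |3 * c + 4 * d * ‖x‖ ^ 2| * (⟪x, δ⟫ ^ 2 / ‖x‖ ^ 2)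
            + 1 / 2 * |c| * ‖x‖ * (α * (‖δ‖ ^ 2 - ⟪x, δ⟫ ^ 2 / ‖x‖ ^ 2)
                + ((‖δ‖ ^ 2 - ⟪x, δ⟫ ^ 2 / ‖x‖ ^ 2) + 4 * (⟪x, δ⟫ ^ 2 / ‖x‖ ^ 2)) / α))
        + (|c| * ‖δ‖ ^ 3 + |d| * (‖δ‖ ^ 2 * (4 * |⟪x, δ⟫| + ‖δ‖ ^ 2)) * ‖x‖ + |d| * (‖x + δ‖ ^ 2 - ‖x‖ ^ 2) ^ 2 * ‖δ‖) := by
  rw [force_remainder_eq₃ x δ a b c d]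
  have hM := norm_main_split_le x δ c d hα hx
  have hT := norm_tail_le x δ c d
  have hE : ‖(b - a - c * (‖x + δ‖ ^ 2 - ‖x‖ ^ 2) - d * (‖x + δ‖ ^ 2 - ‖x‖ ^ 2) ^ 2) • (x + δ)‖
      = |b - a - c * (‖x + δ‖ ^ 2 - ‖x‖ ^ 2) - d * (‖x + δ‖ ^ 2 - ‖x‖ ^ 2) ^ 2| * ‖x + δ‖ := by
    rw [norm_smul, Real.norm_eq_abs]
  refine (norm_add_le _ _).trans ?_
  refine (add_le_add (norm_add_le _ _) le_rfl).trans ?_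
  rw [hE]
  linarith


/-- ★ **LJ pair-force Taylor remainder, RADIAL/TRANSVERSE SPLIT (T1b-F).**  For the tree's force `g x = (‖x‖²)⁻¹^4 • x - (‖x‖²)⁻¹^7 • x` and its
linearisation `L x δ = ψ(‖x‖²) • δ + (2⟪x,δ⟫ ψ′(‖x‖²)) • x`: if `‖δ‖ ≤ η < ‖x‖` and `0 < α`, then with `r = ‖x‖`,
`c = ψ′(r²) = -4(r²)⁻¹^5 + 7(r²)⁻¹^8`, `d = ½ψ″(r²) = 10(r²)⁻¹^6 - 28(r²)⁻¹^9`, `M₃ = max (20((r-η)²)⁻¹^7) (84((r-η)²)⁻¹^10)`, `D = 2rη + η²`,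
`‖g(x+δ) - g x - L x δ‖ ≤ Cr · ⟪x,δ⟫²/‖x‖² + Ct · ‖δ‖²`,
`Cr = r|3c + 4dr²| + ½|c| r (4/α - α - 1/α) + M₃ (r+η) D (4r² + 2rη) + |d| (2r²η + η(4r² + 2rη))`,
`Ct = ½|c| r (α + 1/α) + M₃ (r+η) D² + |c| η + |d| (r+η) D`.
Leading terms: `r|3c + 4dr²| = ½|V_LJ‴(r)|` on the squared RADIAL STRETCH `(δ·x̂)²`, `½(α + 1/α)·r|ψ′(r²)|` on `‖δ‖²` (`α = √3`: the sharp `2/√3`);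
everything else is `O(η)`.  In T2's slot `fR x x'` take `x := x - x'`, `δ := d x - d x'`, `η := dispB x + dispB x'`. [folklore] -/
theorem norm_force_remainder_split_le (x δ : V) {η α : ℝ} (hδ : ‖δ‖ ≤ η) (hη : η < ‖x‖) (hα : 0 < α) :
    ‖((‖x + δ‖ ^ 2)⁻¹ ^ 4 - (‖x + δ‖ ^ 2)⁻¹ ^ 7) • (x + δ) - ((‖x‖ ^ 2)⁻¹ ^ 4 - (‖x‖ ^ 2)⁻¹ ^ 7) • x
        - (((‖x‖ ^ 2)⁻¹ ^ 4 - (‖x‖ ^ 2)⁻¹ ^ 7) • δ + (2 * ⟪x, δ⟫ * (-4 * (‖x‖ ^ 2)⁻¹ ^ 5 + 7 * (‖x‖ ^ 2)⁻¹ ^ 8)) • x)‖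
      ≤ (‖x‖ * |3 * (-4 * (‖x‖ ^ 2)⁻¹ ^ 5 + 7 * (‖x‖ ^ 2)⁻¹ ^ 8) + 4 * (10 * (‖x‖ ^ 2)⁻¹ ^ 6 - 28 * (‖x‖ ^ 2)⁻¹ ^ 9) * ‖x‖ ^ 2|
          + 1 / 2 * |-4 * (‖x‖ ^ 2)⁻¹ ^ 5 + 7 * (‖x‖ ^ 2)⁻¹ ^ 8| * ‖x‖ * (4 / α - α - 1 / α)
          + max (20 * ((‖x‖ - η) ^ 2)⁻¹ ^ 7) (84 * ((‖x‖ - η) ^ 2)⁻¹ ^ 10) * (‖x‖ + η) * (2 * ‖x‖ * η + η ^ 2)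
              * (4 * ‖x‖ ^ 2 + 2 * ‖x‖ * η)
          + |10 * (‖x‖ ^ 2)⁻¹ ^ 6 - 28 * (‖x‖ ^ 2)⁻¹ ^ 9| * (2 * ‖x‖ ^ 2 * η + η * (4 * ‖x‖ ^ 2 + 2 * ‖x‖ * η)))
          * (⟪x, δ⟫ ^ 2 / ‖x‖ ^ 2)
        + (1 / 2 * |-4 * (‖x‖ ^ 2)⁻¹ ^ 5 + 7 * (‖x‖ ^ 2)⁻¹ ^ 8| * ‖x‖ * (α + 1 / α)
          + max (20 * ((‖x‖ - η) ^ 2)⁻¹ ^ 7) (84 * ((‖x‖ - η) ^ 2)⁻¹ ^ 10) * (‖x‖ + η) * (2 * ‖x‖ * η + η ^ 2) ^ 2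
          + |-4 * (‖x‖ ^ 2)⁻¹ ^ 5 + 7 * (‖x‖ ^ 2)⁻¹ ^ 8| * η
          + |10 * (‖x‖ ^ 2)⁻¹ ^ 6 - 28 * (‖x‖ ^ 2)⁻¹ ^ 9| * (‖x‖ + η) * (2 * ‖x‖ * η + η ^ 2))
          * ‖δ‖ ^ 2 := by
  -- (0) basic facts, the scalar remainder and the socket, stated before naming things
  have hδ0 : 0 ≤ ‖δ‖ := norm_nonneg δ
  have hη0 : 0 ≤ η := hδ0.trans hδ
  have hr0 : 0 < ‖x‖ := hη0.trans_lt hη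
  have hx : x ≠ 0 := norm_pos_iff.mp hr0
  have hρ : 0 < (‖x‖ - η) ^ 2 := by have := sub_pos.mpr hη; positivity
  have h₀ : (‖x‖ - η) ^ 2 ≤ ‖x‖ ^ 2 := by nlinarith [norm_nonneg x]
  have h₁ : (‖x‖ - η) ^ 2 ≤ ‖x + δ‖ ^ 2 := sq_le_norm_add_sq_of_le x δ hη le_rfl hδ
  have hE := psi_taylor₃_abs_le hρ h₀ h₁
  have hsock := norm_force_remainder_le_of_scalars₃ x δ ((‖x‖ ^ 2)⁻¹ ^ 4 - (‖x‖ ^ 2)⁻¹ ^ 7)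
    ((‖x + δ‖ ^ 2)⁻¹ ^ 4 - (‖x + δ‖ ^ 2)⁻¹ ^ 7) (-4 * (‖x‖ ^ 2)⁻¹ ^ 5 + 7 * (‖x‖ ^ 2)⁻¹ ^ 8)
    (10 * (‖x‖ ^ 2)⁻¹ ^ 6 - 28 * (‖x‖ ^ 2)⁻¹ ^ 9) hα hx
  have hxδ : ‖x + δ‖ ≤ ‖x‖ + η := (norm_add_le x δ).trans (by linarith)
  have hxδ0 : 0 ≤ ‖x + δ‖ := norm_nonneg _
  have hp_le : |⟪x, δ⟫| ≤ ‖x‖ * ‖δ‖ := abs_real_inner_le_norm x δ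
  have hΔeq : ‖x + δ‖ ^ 2 - ‖x‖ ^ 2 = 2 * ⟪x, δ⟫ + ‖δ‖ ^ 2 := by rw [norm_add_sq_real]; ring
  have hS0 : 0 ≤ ⟪x, δ⟫ ^ 2 / ‖x‖ ^ 2 := by positivity
  have hpS : ⟪x, δ⟫ ^ 2 = ‖x‖ ^ 2 * (⟪x, δ⟫ ^ 2 / ‖x‖ ^ 2) := by field_simp
  have hM₃0 : 0 ≤ max (20 * ((‖x‖ - η) ^ 2)⁻¹ ^ 7) (84 * ((‖x‖ - η) ^ 2)⁻¹ ^ 10) := le_max_of_le_left (by positivity)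
  -- (1) names: from here on everything is polynomial bookkeeping in opaque real variables
  generalize ‖x + δ‖ = m at *
  generalize ‖x‖ = r at *
  generalize ⟪x, δ⟫ = p at *
  generalize ‖δ‖ = n at *
  generalize -4 * (r ^ 2)⁻¹ ^ 5 + 7 * (r ^ 2)⁻¹ ^ 8 = c at *
  generalize 10 * (r ^ 2)⁻¹ ^ 6 - 28 * (r ^ 2)⁻¹ ^ 9 = d at *
  generalize max (20 * ((r - η) ^ 2)⁻¹ ^ 7) (84 * ((r - η) ^ 2)⁻¹ ^ 10) = M₃ at *
  generalize (m ^ 2)⁻¹ ^ 4 - (m ^ 2)⁻¹ ^ 7 = b at *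
  generalize (r ^ 2)⁻¹ ^ 4 - (r ^ 2)⁻¹ ^ 7 = a at *
  generalize hS : p ^ 2 / r ^ 2 = S at *
  generalize hΔ : m ^ 2 - r ^ 2 = Δ at *
  have hD0 : 0 ≤ 2 * r * η + η ^ 2 := by positivity
  have hN : n ^ 2 ≤ η ^ 2 := pow_le_pow_left₀ hδ0 hδ 2
  -- (2) AM–GM: `2|p|n ≤ r(S + n²)`
  have hAMGM : 2 * |p| * n ≤ r * (S + n ^ 2) := by
    have key : 2 * |p| * (r * n) ≤ |p| ^ 2 + (r * n) ^ 2 := by nlinarith [sq_nonneg (|p| - r * n)]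
    have e : r * (r * (S + n ^ 2)) = |p| ^ 2 + (r * n) ^ 2 := by rw [sq_abs, hpS]; ring
    have h3 : r * (2 * |p| * n) ≤ r * (r * (S + n ^ 2)) := by rw [e]; linarith
    exact le_of_mul_le_mul_left h3 hr0
  -- (3) `|Δ| ≤ D`, `Δ² ≤ (4r² + 2rη) S + D n²`, `|Δ|³ ≤ D((4r² + 2rη) S + D n²)`, `D = 2rη + η²`
  have hΔabs : |Δ| ≤ 2 * r * η + η ^ 2 := by
    rw [hΔeq]
    calc |2 * p + n ^ 2| ≤ |2 * p| + |n ^ 2| := abs_add_le _ _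
      _ = 2 * |p| + n ^ 2 := by rw [abs_mul, abs_two, abs_of_nonneg (sq_nonneg n)]
      _ ≤ 2 * (r * n) + n ^ 2 := by linarith
      _ ≤ 2 * r * η + η ^ 2 := by nlinarith
  have hΔsq : Δ ^ 2 ≤ (4 * r ^ 2 + 2 * r * η) * S + (2 * r * η + η ^ 2) * n ^ 2 := by
    have e : Δ ^ 2 = 4 * (r ^ 2 * S) + 2 * (2 * p * n) * n + n ^ 2 * n ^ 2 := by rw [hΔeq, ← hpS]; ring
    rw [e]
    have h1 : 2 * (2 * p * n) * n ≤ 2 * (2 * |p| * n) * n := by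
      have := le_abs_self p
      gcongr
    have h2 : 2 * (2 * |p| * n) * n ≤ 2 * (r * (S + n ^ 2)) * n := by gcongr
    have h3 : 2 * (r * (S + n ^ 2)) * n ≤ 2 * (r * (S + n ^ 2)) * η := by gcongr
    have h5 : n ^ 2 * n ^ 2 ≤ η ^ 2 * n ^ 2 := mul_le_mul_of_nonneg_right hN (sq_nonneg _)
    linarith
  have hΔ3 : |Δ| ^ 3 ≤ (2 * r * η + η ^ 2) * ((4 * r ^ 2 + 2 * r * η) * S + (2 * r * η + η ^ 2) * n ^ 2) := by
    have e : |Δ| ^ 3 = |Δ| * Δ ^ 2 := by rw [← sq_abs Δ]; ring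
    rw [e]
    calc |Δ| * Δ ^ 2 ≤ (2 * r * η + η ^ 2) * Δ ^ 2 := mul_le_mul_of_nonneg_right hΔabs (sq_nonneg Δ)
      _ ≤ (2 * r * η + η ^ 2) * ((4 * r ^ 2 + 2 * r * η) * S + (2 * r * η + η ^ 2) * n ^ 2) :=
          mul_le_mul_of_nonneg_left hΔsq hD0
  -- (4) part 1: the scalar third-order remainder
  have hB0 : 0 ≤ M₃ * ((2 * r * η + η ^ 2) * ((4 * r ^ 2 + 2 * r * η) * S + (2 * r * η + η ^ 2) * n ^ 2)) := by
    positivity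
  have hP1 : |b - a - c * Δ - d * Δ ^ 2| * m
      ≤ M₃ * ((2 * r * η + η ^ 2) * ((4 * r ^ 2 + 2 * r * η) * S + (2 * r * η + η ^ 2) * n ^ 2)) * (r + η) := by
    have h1 : |b - a - c * Δ - d * Δ ^ 2| * m ≤ M₃ * |Δ| ^ 3 * m := mul_le_mul_of_nonneg_right hE hxδ0
    exact h1.trans (mul_le_mul (mul_le_mul_of_nonneg_left hΔ3 hM₃0) hxδ hxδ0 hB0)
  -- (5) part 2: the split MAIN bound, regrouped on `S` and `n²`
  have hP2 : r * |3 * c + 4 * d * r ^ 2| * S + 1 / 2 * |c| * r * (α * (n ^ 2 - S) + ((n ^ 2 - S) + 4 * S) / α)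
      = (r * |3 * c + 4 * d * r ^ 2| + 1 / 2 * |c| * r * (4 / α - α - 1 / α)) * S
        + (1 / 2 * |c| * r * (α + 1 / α)) * n ^ 2 := by
    ring
  -- (6) part 3: the TAIL
  have hP3a : |c| * n ^ 3 ≤ |c| * η * n ^ 2 := by
    have h : n ^ 3 ≤ η * n ^ 2 := by
      calc n ^ 3 = n * n ^ 2 := by ring
        _ ≤ η * n ^ 2 := mul_le_mul_of_nonneg_right hδ (sq_nonneg _)
    have := mul_le_mul_of_nonneg_left h (abs_nonneg c)
    linarith
  have hP3b : |d| * (n ^ 2 * (4 * |p| + n ^ 2)) * r ≤ |d| * (2 * r ^ 2 * η * S + r * (2 * r * η + η ^ 2) * n ^ 2) := by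
    have h1 : n ^ 2 * (4 * |p| + n ^ 2) ≤ 2 * (r * (S + n ^ 2)) * η + η ^ 2 * n ^ 2 := by
      have e : n ^ 2 * (4 * |p| + n ^ 2) = 2 * (2 * |p| * n) * n + n ^ 2 * n ^ 2 := by ring
      rw [e]
      have h2 : 2 * (2 * |p| * n) * n ≤ 2 * (r * (S + n ^ 2)) * n := by gcongr
      have h3 : 2 * (r * (S + n ^ 2)) * n ≤ 2 * (r * (S + n ^ 2)) * η := by gcongr
      have h5 : n ^ 2 * n ^ 2 ≤ η ^ 2 * n ^ 2 := mul_le_mul_of_nonneg_right hN (sq_nonneg _)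
      linarith
    have h1' : |d| * (n ^ 2 * (4 * |p| + n ^ 2) * r) ≤ |d| * ((2 * (r * (S + n ^ 2)) * η + η ^ 2 * n ^ 2) * r) :=
      mul_le_mul_of_nonneg_left (mul_le_mul_of_nonneg_right h1 hr0.le) (abs_nonneg d)
    have e1 : |d| * (n ^ 2 * (4 * |p| + n ^ 2)) * r = |d| * (n ^ 2 * (4 * |p| + n ^ 2) * r) := by ring
    have e2 : |d| * ((2 * (r * (S + n ^ 2)) * η + η ^ 2 * n ^ 2) * r) = |d| * (2 * r ^ 2 * η * S + r * (2 * r * η + η ^ 2) * n ^ 2) := by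
      ring
    rw [e1, ← e2]
    exact h1'
  have hd0 : 0 ≤ |d| * ((4 * r ^ 2 + 2 * r * η) * S + (2 * r * η + η ^ 2) * n ^ 2) := by positivity
  have hP3c : |d| * Δ ^ 2 * n ≤ |d| * ((4 * r ^ 2 + 2 * r * η) * S + (2 * r * η + η ^ 2) * n ^ 2) * η :=
    mul_le_mul (mul_le_mul_of_nonneg_left hΔsq (abs_nonneg d)) hδ hδ0 hd0
  -- (7) assemble
  linarith [hsock, hP1, hP2, hP3a, hP3b, hP3c]

end Summit.AtomisticToContinuum.Crystallization.Theorems.FrustratedLawDichotomyForceRemainderSplit
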